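import Literature.MathematicalPhysics.QuantumFieldTheory.Balaban1983to89.B7Eq208Analytic
import Literature.MathematicalPhysics.QuantumFieldTheory.Balaban1983to89.BlockAveragingFederbush

/-!
# `Balaban1983to89.B7Ineq200General` — T. Bałaban, *Averaging operations for lattice gauge theories*, Commun. Math. Phys. **98**
(1985) 17–51 [Balaban1985Averaging], Sect. F, **(198)/(200) p. 49 «|ṽ′(y) − 1| < α₄ + C′₅Lα′₄» AS PRINTED — WITHOUT AN α₀-TERM
AND WITH `C′₅ = C′₅(d)` — AT A GENERAL `U1`-VALUED BACKGROUND `V₀`**, over the concrete `ℤᵈ` carrier of the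
`B7Prop1Explicit`/`B7Eq99Concrete`/`B7Prop9General` lineage

statement-level skeleton of published theorems with citation tags; proofs where landed; nothing here is a claim about the Yang–Mills mass gap

PDF held: `paper:balaban1985-cmp98-averaging` (journal page = PDF page + 16); pp. 46, 49 read on the renders
`b2b-balaban-ref1/pages/1985-cmp98-averaging/1985-cmp98-averaging-p030-x2.png`, `…-p033-x2.png` (AS IMAGES, this unit, 2026-08-21).

CITATION HEADER (lean-in-tree rule).  Cell `lit-balaban` (HOME `run/shared/lean/pub/lit-balaban/`), unit `lit-balaban-r04` (B7 block
owner, gen 5) — KERNEL PIECE for SKELETON rows **`B7.Prop9`** (member (200)) and `B7.Eq181` ((198)); companion of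
`B7Prop9General.eq200_general`, whose READING (b) it removes for (200): there the flat kernel `B7Prop9Flat.core200` was used as a black
box in the axial gauge, so the non-tree bonds of the block entered and (200) came out as `α₄ + C′₅L(α′₄ + 4dLα₀α₄)`,
`C′₅ = 64(d+1)` — with an `α₀`-term print does not have.

PRINT (p. 46 (180)–(184), p. 49 (198)/(200), verbatim).  «Let us assume that we have a gauge field configuration `V₀` satisfying the
regularity condition `|V₀(∂p) − 1| < α₀, p ⊂ Ω′`, and two gauge transformations `v′, v₁` satisfying the conditions `|v′ − 1| < α₄,
|v′⁻¹(b₋)R_{0,b}v′(b₊) − 1| < α′₄, |v₁ − 1| < α₃, |v₁⁻¹(y)(R₀v₁)(x) − 1| < Lα′₃`, (180) `x ∈ B(y), y ∈ Ω′^{(1)}` … `(\overline{R₀v′v₁})(y) =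
v′(y)v₁(y)·exp[i Σ_{x∈B(y)} L^{−d}(1/i) log(v′v₁)⁻¹(y)(R_{0,y}v′v₁)(x)]`, (181) `(v′v₁)⁻¹(y)(R_{0,y}v′v₁)(x) = R(v₁⁻¹(y))[v′⁻¹(y)(R_{0,y}v′)(x)]·
v₁⁻¹(y)(R_{0,y}v₁)(x)`, (182) and `|v′⁻¹(y)(R_{0,y}v′)(x) − 1| < |Γ_{y,x}|α′₄e^{|Γ_{y,x}|α′₄} = O(Lα′₄)` by (180) …» (p. 49) «From representation
(184) we obtain also `|ṽ′(y) − 1| < α₄ + O(Lα′₄) + O(L²(α′₃ + α′₄)α′₄) ≦ α₄ + O(Lα′₄)`. (198) … **Proposition 9.** … `|ṽ′(y) − 1| <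
α₄ + C′₅Lα′₄`. (200)»  Here `ṽ′ = \overline{R₀v′v₁}(\overline{R₀v₁})⁻¹` ((178)/(179), one step; `B7Prop9General.vtilG`).

WHAT THIS FILE PROVES (kernel, no `sorry`, standard axioms; explicit constants).  **`eq200_printed`**: at ANY background `V₀` with values
in `U1 = {‖u‖ ≤ 1, ‖u⁻¹‖ ≤ 1}` (print: `G ⊂ U(N)`; NO plaquette condition is used), for `v′, v₁` with (180a) `‖v′ − 1‖ ≤ α₄ ≤ ½`,
(180b) `CovBondBd V₀ v′ α′₄`, (180c) `‖v₁ − 1‖ ≤ α₃ ≤ 1/50`, (180d) `CovBlockBd L V₀ v₁ β` with `β ≤ 1/50` (`β` stands for `Lα′₃`), and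
the smallness `100·dLα′₄ ≤ 1`: at every block corner `y = Lz`, **`‖ṽ′(y) − 1‖ ≤ α₄ + 6d·L·α′₄`** — print's (200) with `C′₅ = 6d` and no
`α₀`.  `siteBd_vtilG_printed`: the same packaged as `SiteBd` one scale up (the (180a)-input of the next step of Proposition 10).
THE PROOF = print's (181)–(184)/(198), covariantly (no gauge fixing): with `A_x = v′(y)⁻¹(R_{0,y}v′)(x)` (`‖A_x − 1‖ ≤ 2dLα′₄`:
(180b) telescoped along the tree contour, `B7Prop10InLambda.covBlock_of_covBondBd`), `B_x = v₁(y)⁻¹(R_{0,y}v₁)(x)` (`‖B_x − 1‖ ≤ β`),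
and (182) `P_x = R(v₁(y)⁻¹)A_x·B_x` (`B7Eq208Analytic.prod_cov_split`), the averages (78)/(181) read `\overline{R₀v′v₁}(y) =
v′(y)v₁(y)e^{S_P}`, `\overline{R₀v₁}(y) = v₁(y)e^{S_B}`, `S_• = Σ_x L^{−d} log •_x`, hence `ṽ′(y) = v′(y)·R(v₁(y))[e^{S_P}e^{−S_B}]`;
`‖P_x − B_x‖ ≤ (11/10)·2dLα′₄·(1 + β)` and the Lipschitz bound of the series logarithm on `‖· − 1‖ ≤ 1/20`
(`FederbushMean.norm_mlog_sub_mlog_le`) give `‖S_P − S_B‖ = O(dLα′₄)`, so `‖e^{S_P}e^{−S_B} − 1‖ = O(dLα′₄)`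
(`Literature.Analysis.Complex.norm_exp_sub_exp_le`) and `‖ṽ′(y) − 1‖ ≤ ‖v′(y) − 1‖(1 + δ) + δ ≤ α₄ + 6dLα′₄`.  (Print's finer
(184)/(198) with the BCH remainder `O(L²(α′₃ + α′₄)α′₄)` is not needed for (200).)
READINGS (recorded; none is an objection to print).  (a) `U1`-valued background, Banach reading of `|·|`, `≤` for `<`, all of `ℤᵈ` for
`Ω′`, as in the lineage.  (b) CONSTANTS: `C′₅ = 6d` (print: «there exist positive constants C′₄, C′₅, c′₆»), smallness `c′₆`: `α₄ ≤ ½`,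
`α₃ ≤ 1/50`, `Lα′₃ ≤ 1/50`, `100dLα′₄ ≤ 1` (`d`, `L`-dependent as `B7Prop9Flat` reading (e) allows).  (c) NOT CLAIMED: (199) in print's
shape `Lα′₄ + C′₄L²(α₀α₄ + α′₃α′₄ + α′₄²)` with `C′₄ = C′₄(d)` — the tree's `B7Prop9General.eq199_general` keeps its extra power of `L`
on the `α₀α₄`-term (READING (b) there); print's route (188)–(196) uses the telescoping of `A ≈ Dλ` along closed contours and is not
reproduced here.
REUSED BY NAME: `B7Prop9General.vtilG / CovBondBd / CovBlockBd`, `B7Prop9Flat.SiteBd`, `B7Prop10InLambda.covBlock_of_covBondBd`,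
`B7Eq208Analytic.prod_cov_split / prod_loop_bound`, `B7Eq99Concrete.R0avg / savg / Sexp / R0fun`, `B7Prop1Explicit.U1 / norm_avg_le /
norm_exp_sub_one_le_of_norm_le / exp_sub_one_le_of_le`, `B7Prop6Flat.norm_units_inv_sub_one_le`, `MatrixLog.mlog / norm_mlog_le_two_mul`,
`FederbushMean.norm_mlog_sub_mlog_le`, `Literature.Analysis.Complex.norm_exp_sub_exp_le`.
Unit `lit-balaban-r04` (gen 5), 2026-08-21.

[cite: Balaban1985Averaging, Proposition 9 (200) p.49, (198) p.49, (180)–(184) p.46, (178)–(179) p.45, (78) p.30]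
-/

noncomputable section

open scoped BigOperators
open NormedSpace Finset

namespace Literature.MathematicalPhysics.QuantumFieldTheory.Balaban1983to89.B7Ineq200General

open B7Prop1Explicit B7Prop2Explicit MatrixLog B7Eq92Concrete B7Eq99Concrete B7Eq84Concrete B7Prop9Flat
  B7Prop9General B7Prop10InLambda B7Eq208Analytic
open B7Prop6Flat (norm_units_inv_sub_one_le)

-- `Site` alone would resolve to the torus sites of `Setup.lean`; re-export the `ℤ^d` sites of `B7Prop1Explicit`.
export B7Prop1Explicit (Site)

variable {d : ℕ}

variable {𝔸 : Type*} [NormedRing 𝔸] [NormOneClass 𝔸] [NormedAlgebra ℂ 𝔸] [CompleteSpace 𝔸]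

/-! ## §1 Elementary estimates -/

omit [NormedAlgebra ℂ 𝔸] [CompleteSpace 𝔸] in
/-- `‖u‖ ≤ 1 + ‖u − 1‖`. [folklore] -/
private theorem norm_le_one_add (u : 𝔸) : ‖u‖ ≤ 1 + ‖u - 1‖ := by
  calc ‖u‖ = ‖(u - 1) + 1‖ := by rw [sub_add_cancel]
    _ ≤ ‖u - 1‖ + ‖(1 : 𝔸)‖ := norm_add_le _ _
    _ = 1 + ‖u - 1‖ := by rw [norm_one]; ring

omit [NormedAlgebra ℂ 𝔸] [CompleteSpace 𝔸] in
/-- the rotation step of (182)/(183): `‖R(B⁻¹)X − 1‖ ≤ (11/10)a` for `‖B − 1‖ ≤ 1/50`, `‖X − 1‖ ≤ a` (`R(B⁻¹)X − 1 = B⁻¹(X − 1)B`,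
`‖B⁻¹‖ ≤ 1 + 2/50`, `‖B‖ ≤ 1 + 1/50`). [cite: Balaban1985Averaging, (182)–(183) p.46] -/
theorem norm_Rc_inv_sub_one_le {B X : 𝔸ˣ} {a : ℝ} (hB : ‖(B : 𝔸) - 1‖ ≤ 1 / 50) (hX : ‖(X : 𝔸) - 1‖ ≤ a) :
    ‖(((Rc B⁻¹ X : 𝔸ˣ)) : 𝔸) - 1‖ ≤ 11 / 10 * a := by
  have ha0 : 0 ≤ a := (norm_nonneg _).trans hX
  have hBn : ‖(B : 𝔸)‖ ≤ 1 + 1 / 50 := (norm_le_one_add _).trans (by linarith)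
  have hBi : ‖((B⁻¹ : 𝔸ˣ) : 𝔸)‖ ≤ 1 + 2 / 50 := by
    have h := norm_units_inv_sub_one_le B (hB.trans (by norm_num))
    exact (norm_le_one_add _).trans (by linarith)
  have e : (((Rc B⁻¹ X : 𝔸ˣ)) : 𝔸) - 1 = ((B⁻¹ : 𝔸ˣ) : 𝔸) * ((X : 𝔸) - 1) * (B : 𝔸) := by
    rw [Rc_apply, inv_inv, Units.val_mul, Units.val_mul, mul_sub, sub_mul, mul_one, Units.inv_mul]
  rw [e]
  calc ‖((B⁻¹ : 𝔸ˣ) : 𝔸) * ((X : 𝔸) - 1) * (B : 𝔸)‖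
      ≤ ‖((B⁻¹ : 𝔸ˣ) : 𝔸)‖ * ‖(X : 𝔸) - 1‖ * ‖(B : 𝔸)‖ := by
        calc _ ≤ ‖((B⁻¹ : 𝔸ˣ) : 𝔸) * ((X : 𝔸) - 1)‖ * ‖(B : 𝔸)‖ := norm_mul_le _ _
          _ ≤ _ := by gcongr; exact norm_mul_le _ _
    _ ≤ (1 + 2 / 50) * a * (1 + 1 / 50) := by gcongr
    _ ≤ 11 / 10 * a := by linarith

/-- `‖e^{X}e^{−Y} − 1‖ ≤ ‖X − Y‖·e^{m}·e^{m}` for `‖X‖, ‖Y‖ ≤ m` (`e^{X}e^{−Y} − 1 = (e^{X} − e^{Y})e^{−Y}` and the tree's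
`‖e^{X} − e^{Y}‖ ≤ ‖X − Y‖e^{max(‖X‖,‖Y‖)}`). [folklore] -/
private theorem norm_exp_mul_exp_neg_sub_one_le {X Y : 𝔸} {m : ℝ} (hX : ‖X‖ ≤ m) (hY : ‖Y‖ ≤ m) :
    ‖exp X * exp (-Y) - 1‖ ≤ ‖X - Y‖ * Real.exp m * Real.exp m := by
  have hinv : exp Y * exp (-Y) = (1 : 𝔸) := by
    have h := (expUnit Y).mul_inv
    rwa [val_inv_expUnit, val_expUnit, val_expUnit] at h
  have e : exp X * exp (-Y) - 1 = (exp X - exp Y) * exp (-Y) := by rw [sub_mul, hinv]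
  rw [e]
  have h1 : ‖exp X - exp Y‖ ≤ ‖X - Y‖ * Real.exp m := by
    refine (Literature.Analysis.Complex.norm_exp_sub_exp_le X Y).trans ?_
    gcongr
    exact max_le hX hY
  have h2 : ‖exp (-Y)‖ ≤ Real.exp m := by
    have h := (norm_exp_sub_one_le_of_norm_le (show ‖-Y‖ ≤ m by rwa [norm_neg])).1
    have h' : ‖exp (-Y)‖ ≤ 1 + ‖exp (-Y) - 1‖ := by
      calc ‖exp (-Y)‖ = ‖(exp (-Y) - 1) + 1‖ := by rw [sub_add_cancel]
        _ ≤ ‖exp (-Y) - 1‖ + ‖(1 : 𝔸)‖ := norm_add_le _ _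
        _ = ‖exp (-Y) - 1‖ + 1 := by rw [norm_one]
        _ = 1 + ‖exp (-Y) - 1‖ := by ring
    linarith
  calc ‖(exp X - exp Y) * exp (-Y)‖ ≤ ‖exp X - exp Y‖ * ‖exp (-Y)‖ := norm_mul_le _ _
    _ ≤ (‖X - Y‖ * Real.exp m) * Real.exp m := by
        gcongr
    _ = _ := by ring

/-! ## §2 (198)/(200) as printed at a general background -/

/-- **(198)/(200) AS PRINTED, AT A GENERAL `U1`-VALUED BACKGROUND** (p. 49: «From representation (184) we obtain also
`|ṽ′(y) − 1| < α₄ + O(Lα′₄) + O(L²(α′₃ + α′₄)α′₄) ≦ α₄ + O(Lα′₄)`. (198) … **Proposition 9.** … `|ṽ′(y) − 1| < α₄ + C′₅Lα′₄`. (200)»).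
HERE: `V₀` with values in `U1` (NO plaquette/regularity condition on `V₀` is used — print's (198) has no `α₀`-term either), `v′, v₁`
with (180a) `SiteBd v′ α₄`, `α₄ ≤ ½`, (180b) `CovBondBd V₀ v′ α′₄`, `0 ≤ α′₄`, (180c) `SiteBd v₁ α₃`, `α₃ ≤ 1/50`, (180d)
`CovBlockBd L V₀ v₁ β`, `β ≤ 1/50` (print's `Lα′₃`), smallness `100dLα′₄ ≤ 1`, `L ≥ 1`; CONCLUSION at every block corner `y = Lz`:
`‖ṽ′(y) − 1‖ ≤ α₄ + 6d·L·α′₄` (`ṽ′ = vtilG L V₀ v′ v₁`), i.e. (200) with `C′₅ = 6d`.  PROOF: (181)/(182) covariantly — see the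
module docstring. [cite: Balaban1985Averaging, Proposition 9 (200) p.49, (198) p.49, (181)–(184) p.46, (78) p.30] -/
theorem eq200_printed {L : ℕ} (hL : 1 ≤ L) {V₀ : Site d → Fin d → 𝔸ˣ} (hV : ∀ x κ, V₀ x κ ∈ U1 𝔸)
    {v' v₁ : Site d → 𝔸ˣ} {α₃ α₄ α₄' β : ℝ}
    (h4a : SiteBd v' α₄) (h4b : CovBondBd V₀ v' α₄') (h3c : SiteBd v₁ α₃) (h3d : CovBlockBd L V₀ v₁ β)
    (hα₄ : α₄ ≤ 1 / 2) (hα₄' : 0 ≤ α₄') (hα₃ : α₃ ≤ 1 / 50) (hβ : β ≤ 1 / 50)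
    (hs : 100 * ((d : ℝ) * L * α₄') ≤ 1) (z : Site d) :
    ‖((vtilG L V₀ v' v₁ ((L : ℤ) • z) : 𝔸ˣ) : 𝔸) - 1‖ ≤ α₄ + 6 * d * L * α₄' := by
  set y : Site d := (L : ℤ) • z with hy
  -- abbreviations
  set a : ℝ := 2 * ((d : ℝ) * L * α₄') with ha
  have hd : (0 : ℝ) ≤ d := Nat.cast_nonneg d
  have ha0 : 0 ≤ a := by rw [ha]; positivity
  have ha1 : a ≤ 1 / 50 := by rw [ha]; linarith
  have hα₄0 : 0 ≤ α₄ := (norm_nonneg _).trans (h4a 0)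
  have hβ0 : 0 ≤ β := (norm_nonneg _).trans (h3d z fun _ => ⟨0, hL⟩)
  have hα₃0 : 0 ≤ α₃ := (norm_nonneg _).trans (h3c 0)
  -- the block quantities (182)
  set A : (Fin d → Fin L) → 𝔸ˣ := fun r => (v' y)⁻¹ * R0fun V₀ y v' (y + boxVec L r) with hA
  set B : (Fin d → Fin L) → 𝔸ˣ := fun r => (v₁ y)⁻¹ * R0fun V₀ y v₁ (y + boxVec L r) with hB
  set P : (Fin d → Fin L) → 𝔸ˣ := fun r => ((v' * v₁) y)⁻¹ * R0fun V₀ y (v' * v₁) (y + boxVec L r) with hP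
  have hAb : ∀ r, ‖((A r : 𝔸ˣ) : 𝔸) - 1‖ ≤ a := fun r => by
    simp only [hA, R0fun_add]
    exact covBlock_of_covBondBd hV h4b hα₄' (by linarith) y r
  have hBb : ∀ r, ‖((B r : 𝔸ˣ) : 𝔸) - 1‖ ≤ β := fun r => h3d z r
  have hsplit : ∀ r, P r = Rc (v₁ y)⁻¹ (A r) * B r := fun r => by
    simp only [hP, hA, hB, Pi.mul_apply, R0fun_apply, Rc_apply, mul_inv_rev, inv_inv]
    group
  have hv₁y : ‖((v₁ y : 𝔸ˣ) : 𝔸) - 1‖ ≤ 1 / 50 := (h3c y).trans hα₃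
  -- `‖P_r − 1‖ ≤ (6/5)a + β` and `‖P_r − B_r‖ ≤ (11/10)a(1 + β)`
  have hP1 : ∀ r, ‖((P r : 𝔸ˣ) : 𝔸) - 1‖ ≤ 6 / 5 * a + β := fun r => by
    rw [hsplit]; exact prod_loop_bound ((h3c y).trans le_rfl) hα₃ (hAb r) (hBb r) hβ
  have hPB : ∀ r, ‖((P r : 𝔸ˣ) : 𝔸) - ((B r : 𝔸ˣ) : 𝔸)‖ ≤ 11 / 10 * a * (1 + β) := fun r => by
    have hR := norm_Rc_inv_sub_one_le hv₁y (hAb r)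
    have e : ((P r : 𝔸ˣ) : 𝔸) - ((B r : 𝔸ˣ) : 𝔸) = ((((Rc (v₁ y)⁻¹ (A r) : 𝔸ˣ)) : 𝔸) - 1) * ((B r : 𝔸ˣ) : 𝔸) := by
      rw [hsplit, Units.val_mul, sub_mul, one_mul]
    rw [e]
    calc _ ≤ ‖(((Rc (v₁ y)⁻¹ (A r) : 𝔸ˣ)) : 𝔸) - 1‖ * ‖((B r : 𝔸ˣ) : 𝔸)‖ := norm_mul_le _ _
      _ ≤ 11 / 10 * a * (1 + β) := by
          have hBn : ‖((B r : 𝔸ˣ) : 𝔸)‖ ≤ 1 + β := (norm_le_one_add _).trans (by linarith [hBb r])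
          have h0 : 0 ≤ 11 / 10 * a := by positivity
          exact mul_le_mul hR hBn (norm_nonneg _) h0
  -- the logarithms: Lipschitz on `‖· − 1‖ ≤ 1/20`
  have hρP : ∀ r, ‖((P r : 𝔸ˣ) : 𝔸) - 1‖ ≤ 1 / 20 := fun r => (hP1 r).trans (by linarith)
  have hρB : ∀ r, ‖((B r : 𝔸ˣ) : 𝔸) - 1‖ ≤ 1 / 20 := fun r => (hBb r).trans (by linarith)
  have hlog : ∀ r, ‖mlog ((P r : 𝔸ˣ) : 𝔸) - mlog ((B r : 𝔸ˣ) : 𝔸)‖ ≤ 6 / 5 * a := fun r => by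
    have h := FederbushMean.norm_mlog_sub_mlog_le (ρ := 1 / 20) (by norm_num) (hρP r) (hρB r)
    refine h.trans ?_
    have hc : (1 + (1 / 20 : ℝ) / (1 - 1 / 20)) = 20 / 19 := by norm_num
    rw [hc]
    calc (20 : ℝ) / 19 * ‖((P r : 𝔸ˣ) : 𝔸) - ((B r : 𝔸ˣ) : 𝔸)‖ ≤ 20 / 19 * (11 / 10 * a * (1 + β)) := by
          gcongr; exact hPB r
      _ ≤ 6 / 5 * a := by nlinarith
  -- the exponents `S_P`, `S_B` of the two averages (78)
  set SP : 𝔸 := Sexp L (R0fun V₀ y (v' * v₁)) y with hSP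
  set SB : 𝔸 := Sexp L (R0fun V₀ y v₁) y with hSB
  have hSP' : SP = ∑ r : Fin d → Fin L, (((L : ℝ) ^ d)⁻¹) • mlog ((P r : 𝔸ˣ) : 𝔸) := by
    simp only [hSP, Sexp_apply, R0fun_self, hP]
  have hSB' : SB = ∑ r : Fin d → Fin L, (((L : ℝ) ^ d)⁻¹) • mlog ((B r : 𝔸ˣ) : 𝔸) := by
    simp only [hSB, Sexp_apply, R0fun_self, hB]
  have hdiff : ‖SP - SB‖ ≤ 6 / 5 * a := by
    rw [hSP', hSB', ← Finset.sum_sub_distrib]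
    simp only [← smul_sub]
    exact norm_avg_le L hL _ hlog
  have hSBn : ‖SB‖ ≤ 1 / 10 := by
    rw [hSB']
    refine norm_avg_le L hL _ fun r => ?_
    exact (norm_mlog_le_two_mul ((hρB r).trans (by norm_num))).trans (by linarith [hρB r])
  have hSPn : ‖SP‖ ≤ 1 / 10 := by
    rw [hSP']
    refine norm_avg_le L hL _ fun r => ?_
    exact (norm_mlog_le_two_mul ((hρP r).trans (by norm_num))).trans (by linarith [hρP r])
  -- `‖e^{S_P}e^{−S_B} − 1‖ ≤ (6/5)a·e^{1/10}·e^{1/10} ≤ (7/4)a`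
  have hE : ‖exp SP * exp (-SB) - 1‖ ≤ 7 / 4 * a := by
    have h := norm_exp_mul_exp_neg_sub_one_le hSPn hSBn
    have he : Real.exp (1 / 10 : ℝ) ≤ 6 / 5 := by
      have h2 := Real.abs_exp_sub_one_le (x := (1 / 10 : ℝ)) (by rw [abs_of_nonneg (by norm_num)]; norm_num)
      rw [abs_of_nonneg (by norm_num : (0 : ℝ) ≤ 1 / 10)] at h2
      linarith [le_abs_self (Real.exp (1 / 10 : ℝ) - 1)]
    have he0 : 0 ≤ Real.exp (1 / 10 : ℝ) := (Real.exp_pos _).le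
    calc _ ≤ ‖SP - SB‖ * Real.exp (1 / 10) * Real.exp (1 / 10) := h
      _ ≤ 6 / 5 * a * (6 / 5) * (6 / 5) := by gcongr
      _ ≤ 7 / 4 * a := by linarith
  -- the representation `ṽ′(y) = v′(y)·R(v₁(y))[e^{S_P}e^{−S_B}]` ((181), (78))
  have hrep : ((vtilG L V₀ v' v₁ y : 𝔸ˣ) : 𝔸) =
      ((v' y : 𝔸ˣ) : 𝔸) * (((v₁ y : 𝔸ˣ) : 𝔸) * (exp SP * exp (-SB)) * (((v₁ y)⁻¹ : 𝔸ˣ) : 𝔸)) := by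
    rw [vtilG_apply, R0avg, R0avg, savg_apply, savg_apply, R0fun_self, R0fun_self]
    simp only [Units.val_mul, mul_inv_rev, val_inv_expUnit, val_expUnit, Pi.mul_apply, ← hSP, ← hSB]
    noncomm_ring
  -- the conjugated exponential `R(v₁(y))[E]` is within `δ = (19/10)a` of `1`
  set E : 𝔸 := exp SP * exp (-SB) with hEdef
  set Rv : 𝔸 := ((v₁ y : 𝔸ˣ) : 𝔸) * E * (((v₁ y)⁻¹ : 𝔸ˣ) : 𝔸) with hRv
  have hv₁n : ‖((v₁ y : 𝔸ˣ) : 𝔸)‖ ≤ 1 + 1 / 50 := (norm_le_one_add _).trans (by linarith)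
  have hv₁i : ‖(((v₁ y)⁻¹ : 𝔸ˣ) : 𝔸)‖ ≤ 1 + 2 / 50 := by
    have h := norm_units_inv_sub_one_le (v₁ y) (hv₁y.trans (by norm_num))
    exact (norm_le_one_add _).trans (by linarith)
  have hRv1 : ‖Rv - 1‖ ≤ 19 / 10 * a := by
    have e : Rv - 1 = ((v₁ y : 𝔸ˣ) : 𝔸) * (E - 1) * (((v₁ y)⁻¹ : 𝔸ˣ) : 𝔸) := by
      rw [hRv, mul_sub, sub_mul, mul_one, Units.mul_inv]
    rw [e]
    calc _ ≤ ‖((v₁ y : 𝔸ˣ) : 𝔸)‖ * ‖E - 1‖ * ‖(((v₁ y)⁻¹ : 𝔸ˣ) : 𝔸)‖ := by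
          calc _ ≤ ‖((v₁ y : 𝔸ˣ) : 𝔸) * (E - 1)‖ * ‖(((v₁ y)⁻¹ : 𝔸ˣ) : 𝔸)‖ := norm_mul_le _ _
            _ ≤ _ := by gcongr; exact norm_mul_le _ _
      _ ≤ (1 + 1 / 50) * (7 / 4 * a) * (1 + 2 / 50) := by gcongr
      _ ≤ 19 / 10 * a := by linarith
  -- assemble: `ṽ′ − 1 = (v′ − 1)·Rv + (Rv − 1)`
  have hfin : ((vtilG L V₀ v' v₁ y : 𝔸ˣ) : 𝔸) - 1 = (((v' y : 𝔸ˣ) : 𝔸) - 1) * Rv + (Rv - 1) := by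
    rw [hrep]; noncomm_ring
  rw [hfin]
  have hRvn : ‖Rv‖ ≤ 1 + 19 / 10 * a := (norm_le_one_add _).trans (by linarith)
  calc ‖(((v' y : 𝔸ˣ) : 𝔸) - 1) * Rv + (Rv - 1)‖ ≤ ‖(((v' y : 𝔸ˣ) : 𝔸) - 1) * Rv‖ + ‖Rv - 1‖ := norm_add_le _ _
    _ ≤ α₄ * (1 + 19 / 10 * a) + 19 / 10 * a := by
        gcongr
        exact (norm_mul_le _ _).trans (mul_le_mul (h4a y) hRvn (norm_nonneg _) hα₄0)
    _ ≤ α₄ + 6 * d * L * α₄' := by rw [ha]; nlinarith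

/-- **(200) as printed, packaged one scale up**: under the hypotheses of `eq200_printed` the coarse function `z ↦ ṽ′(Lz)` satisfies the
site condition (180a)/(176) of the next step with the constant `α₄ + 6dLα′₄` (the `SiteBd` half of `B7Prop9General.prop9_general`,
now without `α₀`). [cite: Balaban1985Averaging, Proposition 9 (200) p.49, (201)–(206) p.49] -/
theorem siteBd_vtilG_printed {L : ℕ} (hL : 1 ≤ L) {V₀ : Site d → Fin d → 𝔸ˣ} (hV : ∀ x κ, V₀ x κ ∈ U1 𝔸)
    {v' v₁ : Site d → 𝔸ˣ} {α₃ α₄ α₄' β : ℝ}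
    (h4a : SiteBd v' α₄) (h4b : CovBondBd V₀ v' α₄') (h3c : SiteBd v₁ α₃) (h3d : CovBlockBd L V₀ v₁ β)
    (hα₄ : α₄ ≤ 1 / 2) (hα₄' : 0 ≤ α₄') (hα₃ : α₃ ≤ 1 / 50) (hβ : β ≤ 1 / 50)
    (hs : 100 * ((d : ℝ) * L * α₄') ≤ 1) :
    SiteBd (fun z => vtilG L V₀ v' v₁ ((L : ℤ) • z)) (α₄ + 6 * d * L * α₄') :=
  fun z => eq200_printed hL hV h4a h4b h3c h3d hα₄ hα₄' hα₃ hβ hs z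

/-- **(200) as printed with (180d) in print's letter `β = Lα′₃`** and the flat comparison: the same bound, hypotheses exactly those of
`B7Prop9General.eq200_general` except that NO `α₀`/plaquette hypothesis appears and the smallness is `100dLα′₄ ≤ 1`, `50Lα′₃ ≤ 1`.
[cite: Balaban1985Averaging, Proposition 9 (200) p.49, (180) p.46] -/
theorem eq200_printed' {L : ℕ} (hL : 1 ≤ L) {V₀ : Site d → Fin d → 𝔸ˣ} (hV : ∀ x κ, V₀ x κ ∈ U1 𝔸)
    {v' v₁ : Site d → 𝔸ˣ} {α₃ α₃' α₄ α₄' : ℝ}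
    (h4a : SiteBd v' α₄) (h4b : CovBondBd V₀ v' α₄') (h3c : SiteBd v₁ α₃) (h3d : CovBlockBd L V₀ v₁ (L * α₃'))
    (hα₄ : α₄ ≤ 1 / 2) (hα₄' : 0 ≤ α₄') (hα₃ : α₃ ≤ 1 / 50) (hα₃' : 50 * (L * α₃') ≤ 1)
    (hs : 100 * ((d : ℝ) * L * α₄') ≤ 1) (z : Site d) :
    ‖(((R0avg L V₀ (v' * v₁) ((L : ℤ) • z) * (R0avg L V₀ v₁ ((L : ℤ) • z))⁻¹ : 𝔸ˣ)) : 𝔸) - 1‖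
      ≤ α₄ + 6 * d * L * α₄' := by
  have h := eq200_printed hL hV h4a h4b h3c h3d hα₄ hα₄' hα₃ (by linarith) hs z
  rwa [vtilG_apply] at h

end Literature.MathematicalPhysics.QuantumFieldTheory.Balaban1983to89.B7Ineq200General

end
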